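import Summits.QuantumFields.BalabanUV.T4Continuum.Support.NE3RightInverseSolveLetters
import Summits.QuantumFields.BalabanUV.T4Continuum.Support.NE3RightInverseSupLetters
import Summits.QuantumFields.BalabanUV.T4Continuum.Support.NE3CovLiftCurl
import HarnessLib

/-!
# T⁴ programme, node NE3 — route Π, row Π-R (curved step), file Π-R-W6b¹: THE ACCUMULATED FRAME GENERATOR IS LOCAL —
# `‖frameGen L k W Φ z‖ ≤ frameC·liftC · sup{‖Φ(z',κ')‖ : |z' − z|₁ ≤ frameRad}`, its ℓ² and ℓ¹ sums over the coarse torus, and the ℓ² of a gauge direction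

NE3 (node U1b) formalisation swarm, leaf seat `b2b-balaban-t4-ne3-formalise-leaf-01` (gen 8); row Π-R-W, split of the letters with leaf-02-g8 (journal
2026-08-21 ≈01:14Z).  W6a (`NE3RightInverseSupLetters.norm_framePotW_le_of_sup`) bounded the accumulated frame generator `G = frameGen L k W Φ =
framePotW L (k+1) W (covLift M W Φ)` against the GLOBAL sup of the lift.  The ℓ²∕ℓ¹ letters need the LOCAL form: `G(z)` reads `Φ` only on the coarse
ℓ¹-ball of radius `frameRad = nbRad + d² + 2d` about `z` (k-FREE) — the Fbar reading box `box (dL) (L^{m'}•z)` (`NE3FramePotBoundW.norm_Fbar_le`), W4b's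
ball-form sup tower `NE3QbarIterNearFlat.norm_QbarIter_le_two_mul` re-centred at `blk (L^{m'}) y'` (offset `|res|₁ ≤ d(L^{m'} − 1) ≤ nbRad·Σ_{i<m'}L^i`), and
the block locality of the lift (`‖covLift M W Φ (x,μ)‖ ≤ liftC∕M·‖Φ(blk M x, μ)‖`, W4c¹ `l1_blk_sub_le`).  Summed with W6b⁰'s multiplicity identity:
`Σ_{z∈periodBox N}‖G z‖² ≤ (frameC·liftC)²·#l1Ball(frameRad)·dirSq Φ (periodBox N)` and the ℓ¹ twin; plus the elementary ℓ² bound of a gauge direction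
`Σ_{z,α}‖gaugeDir U m z α‖² ≤ 4d·Σ_z‖m z‖²` (periodic `m`).

CONTENT ([folklore]; 0 sorry; DATA def `frameRad` — explicit): §1 ℓ¹ bookkeeping; §2 **`norm_frameGen_le_loc`**; §3 **`sum_normSq_frameGen_le`**,
**`sum_norm_frameGen_le`**; §4 `sum_normSq_gaugeDir_le`.

HONEST FRAMING.  Kinematics of OUR objects; constants explicit and crude; nothing about minimisers; (P♮)_W, T-E_w and **NE3 are NOT proved**; spine PROVED
0∕9; finite T⁴ rung (B)+1 — NOT infinite volume, NOT mass gap, NOT `BetaPertH`, NOT Clay.  PLACEMENT: `Summits/QuantumFields/BalabanUV/`.  HONEST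
DEPENDENCY (cell page 1): continuum YM on T⁴ ⇐ BetaPertH ∧ nine spine estimates (0/9 proved); BetaPertH ⇐ (D1) ∧ (D4) ∧ CAP+tail; G-an2-4 gates asym,
D1 and NE2/3/4.
-/

set_option autoImplicit false

open scoped BigOperators Matrix.Norms.L2Operator
open Finset

namespace Summit.QuantumFields.BalabanUV.T4Continuum.NE3FrameGenLocal

open Literature.MathematicalPhysics.QuantumFieldTheory.Balaban1983to89
open B7Prop1Explicit B7Prop2Explicit
open T4AveragingDeficitWall (IsUnitaryCfg SmallField Ad dirSq dirL1 box)
open T4AveragingDeficitWallBoundary (periodBox sum_periodBox_shift)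
open AveragingDeficitPeriodicCounting (IsPeriodicDir)
open AveragingDeficitTransport (norm_Ad_of_unitary)
open AveragingDeficitMultiLevelPrep (cavgIter LevelSmall)
open AveragingDeficitCounting (card_box_eq mem_box_iff)
open AveragingDeficitLiftDefectSum (natAbs_le_l1)
open BlockAverageVaryHolo (nbRad)
open BlockAveragePushDirGauge (gaugeDir)
open SmoothRefineBlocks (blk res blk_add_res res_nonneg res_le)
open NE3TangentCovariantStructure (Fbar)
open NE3TangentCovariantTower (QbarIter framePotW)
open NE3FramePotBoundW (framePotW_eq_sum norm_Fbar_le)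
open NE3SmoothLiftBounds (norm_smoothLift_le)
open NE3CovariantLift (covLift frameGen norm_covLift_eq)
open NE3QbarIterNearFlat (norm_QbarIter_le_two_mul)
open NE3QbarIterCovLiftPrep (liftC liftC_nonneg class_at_level sum_pow_le_pow sum_pow_le_pow_real l1_blk_sub_le)
open NE3RightInverseSupLetters (frameC)
open NE3RightInverseSolveLetters (l1Ball mem_l1Ball sum_periodBox_sum_l1Ball norm_le_locL1 norm_le_locL2)
open NE3CovLiftCurl (l1_sub_smul_blk_le)

noncomputable section

variable {d : ℕ} {n : Type*} [Fintype n] [DecidableEq n]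

/-! ## §1 ℓ¹ bookkeeping -/

omit [Fintype n] [DecidableEq n] in
/-- A point of the sup-box `box R c` is within ℓ¹-distance `d·R` of the centre. [folklore] -/
theorem l1_sub_le_of_mem_box {R : ℕ} {c y : Site d} (hy : y ∈ box R c) : l1 (y - c) ≤ d * R := by
  rw [mem_box_iff] at hy
  unfold l1
  calc ∑ κ : Fin d, ((y - c) κ).natAbs ≤ ∑ _κ : Fin d, R := Finset.sum_le_sum fun κ _ => by
          have h := hy κ
          have : ((((y - c) κ).natAbs : ℕ) : ℤ) ≤ R := by rw [Int.natCast_natAbs]; exact h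
          exact_mod_cast this
    _ = d * R := by rw [Finset.sum_const, Finset.card_univ, Fintype.card_fin, smul_eq_mul]

omit [Fintype n] [DecidableEq n] in
/-- The offset fits W4b's reading ball: `d·(L^m − 1) ≤ nbRad·Σ_{i<m} L^i` (`L ≥ 1`; `d(L−1) ≤ nbRad = 2dL + 2L`). [folklore] -/
theorem d_mul_pow_sub_one_le {L : ℕ} (hL : 1 ≤ L) : ∀ m : ℕ, d * (L ^ m - 1) ≤ nbRad d L * ∑ i ∈ Finset.range m, L ^ i
  | 0 => by simp
  | m + 1 => by
      have ih := d_mul_pow_sub_one_le hL m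
      have hpow : 1 ≤ L ^ m := Nat.one_le_pow _ _ (by omega)
      have hS : ∑ i ∈ Finset.range (m + 1), L ^ i = L * (∑ i ∈ Finset.range m, L ^ i) + 1 := by
        rw [Finset.sum_range_succ', pow_zero, Finset.mul_sum]
        exact congrArg (· + 1) (Finset.sum_congr rfl fun i _ => by ring)
      rw [hS]
      have h1 : L ^ (m + 1) - 1 = L * (L ^ m - 1) + (L - 1) := by
        rw [pow_succ, Nat.mul_sub_one, mul_comm]
        have : L ≤ L * L ^ m := Nat.le_mul_of_pos_right L hpow
        omega
      rw [h1]
      have hnb : d * (L - 1) ≤ nbRad d L := by unfold nbRad; have := Nat.sub_le L 1; nlinarith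
      have key : d * (L * (L ^ m - 1)) ≤ nbRad d L * (L * ∑ i ∈ Finset.range m, L ^ i) := by
        have := Nat.mul_le_mul_left L ih
        nlinarith
      nlinarith

/-- `dirL1` on a sup-box against a sup ON THE BOX: `dirL1 V (box R c) ≤ (2R+1)^d·d·s`. [folklore] -/
theorem dirL1_box_le_of_sup_on (V : Site d → Fin d → Matrix n n ℂ) (R : ℕ) (c : Site d) {s : ℝ}
    (hV : ∀ x ∈ box R c, ∀ (μ : Fin d), ‖V x μ‖ ≤ s) : dirL1 V (box R c) ≤ ((2 * R + 1 : ℕ) : ℝ) ^ d * (d * s) := by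
  unfold dirL1
  calc ∑ x ∈ box R c, ∑ κ : Fin d, ‖V x κ‖ ≤ ∑ _x ∈ box R c, ∑ _κ : Fin d, s :=
        Finset.sum_le_sum fun x hx => Finset.sum_le_sum fun κ _ => hV x hx κ
    _ = ((2 * R + 1 : ℕ) : ℝ) ^ d * (d * s) := by
        rw [Finset.sum_const, Finset.sum_const, Finset.card_univ, Fintype.card_fin, card_box_eq, nsmul_eq_mul, nsmul_eq_mul]; push_cast; ring

/-! ## §2 The accumulated frame generator is local -/

/-- THE FRAME RADIUS: `frameRad = nbRad + d² + 2d` coarse ℓ¹-steps (k-FREE). [folklore] -/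
def frameRad (d L : ℕ) : ℕ := nbRad d L + d ^ 2 + 2 * d

/-- **THE ACCUMULATED FRAME GENERATOR IS LOCAL** (`L ≥ 2`, class): if `‖Φ z' κ'‖ ≤ s` on the coarse ℓ¹-ball `|z' − z|₁ ≤ frameRad`, then
`‖frameGen L k W Φ z‖ ≤ frameC·liftC·s`. [folklore] -/
theorem norm_frameGen_le_loc [Nonempty n] {L : ℕ} (hL : 2 ≤ L) (k : ℕ) {W : Site d → Fin d → (Matrix n n ℂ)ˣ} {x : ℝ}
    (hWu : IsUnitaryCfg W) (hx : 0 ≤ x) (hs : LevelSmall d L k x) (hWx : SmallField W x) (Φ : Site d → Fin d → Matrix n n ℂ) (z : Site d)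
    {s : ℝ} (hs0 : 0 ≤ s) (hΦ : ∀ (z' : Site d) (κ' : Fin d), l1 (z' - z) ≤ frameRad d L → ‖Φ z' κ'‖ ≤ s) :
    ‖frameGen L k W Φ z‖ ≤ frameC d L * liftC d * s := by
  have hL1 : 1 ≤ L := by omega
  obtain ⟨M, hM⟩ : ∃ M : ℕ, M = L ^ (k + 1) := ⟨_, rfl⟩
  have hM1 : 1 ≤ M := by rw [hM]; exact Nat.one_le_pow _ _ (by omega)
  have hM2 : 2 ≤ M := by
    rw [hM]; calc 2 ≤ L := hL
      _ = L ^ 1 := (pow_one L).symm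
      _ ≤ L ^ (k + 1) := Nat.pow_le_pow_right (by omega) (by omega)
  have hMr : ((M : ℕ) : ℝ) = (L : ℝ) ^ (k + 1) := by rw [hM]; push_cast; ring
  have hM0 : (0 : ℝ) < (M : ℝ) := by exact_mod_cast (show 0 < M by omega)
  have hcast : ∀ j : ℕ, ((L ^ j : ℕ) : ℤ) = (L : ℤ) ^ j := fun j => by push_cast; rfl
  have hlift0 : 0 ≤ liftC d / M * s := by have := liftC_nonneg d; positivity
  -- (i) the lift near a re-centred base `c'` with `|c' − z|₁ ≤ d² + d`
  have hY : ∀ c' : Site d, l1 (c' - z) ≤ d ^ 2 + d → ∀ (x'' : Site d) (μ : Fin d),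
      l1 (x'' - ((L : ℤ) ^ (k + 1)) • c') ≤ nbRad d L * ∑ i ∈ Finset.range (k + 1), L ^ i → ‖covLift M W Φ x'' μ‖ ≤ liftC d / M * s := by
    intro c' hc' x'' μ hx''
    have hd : 1 ≤ d := μ.pos
    rw [norm_covLift_eq hWu]
    refine (norm_smoothLift_le hM2 hd Φ x'' μ).trans ?_
    rw [liftC]
    refine mul_le_mul_of_nonneg_left (hΦ _ _ ?_) (by positivity)
    have h1 : l1 (x'' - (M : ℤ) • c') ≤ M * nbRad d L := by
      rw [hM, hcast, Nat.mul_comm]; exact hx''.trans (Nat.mul_le_mul_left _ (sum_pow_le_pow hL (k + 1)))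
    have h2 : l1 (blk M x'' - c') ≤ nbRad d L + d := l1_blk_sub_le hM1 h1
    have h3 : blk M x'' - z = (blk M x'' - c') + (c' - z) := by abel
    rw [h3]
    refine (l1_add_le _ _).trans ?_
    unfold frameRad; nlinarith
  -- (ii) per-level bound of the Fbar terms
  have hterm : ∀ m ∈ Finset.range (k + 1), ‖Fbar L (cavgIter L m W) (QbarIter L m W (covLift M W Φ)) (((L : ℤ) ^ (k + 1 - 1 - m)) • z)‖
      ≤ (d * L : ℝ) * (((2 * (d * L) + 1 : ℕ) : ℝ) ^ d * (d * (2 * (L : ℝ) ^ m * (liftC d / M * s)))) := by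
    intro m hm
    have hmk : m ≤ k := Nat.lt_succ_iff.mp (Finset.mem_range.mp hm)
    obtain ⟨hu, -, -, -⟩ := class_at_level hL1 hWu hx hs hWx m hmk
    refine (norm_Fbar_le hL1 hu _ _).trans (mul_le_mul_of_nonneg_left ?_ (by positivity))
    refine dirL1_box_le_of_sup_on _ _ _ fun y' hy' μ => ?_
    -- re-centre at `c' := blk (L^{m'}) y'`, `m' = k + 1 − m ≥ 1`
    obtain ⟨m', hm'⟩ : ∃ m' : ℕ, m' = k + 1 - m := ⟨_, rfl⟩
    have hm'1 : 1 ≤ m' := by omega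
    have him : m + m' = k + 1 := by omega
    have hP1 : 1 ≤ L ^ m' := Nat.one_le_pow _ _ (by omega)
    have hcen : (L : ℤ) • (((L : ℤ) ^ (k + 1 - 1 - m)) • z) = ((L : ℤ) ^ m') • z := by
      rw [smul_smul, ← pow_succ', hm']; congr 2; omega
    rw [hcen] at hy'
    set c' : Site d := blk (L ^ m') y' with hc'
    have hyc : l1 (y' - ((L : ℤ) ^ m') • c') ≤ nbRad d L * ∑ i ∈ Finset.range m', L ^ i := by
      rw [← hcast]; exact (l1_sub_smul_blk_le hP1 y').trans (d_mul_pow_sub_one_le hL1 m')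
    have hcz : l1 (c' - z) ≤ d ^ 2 + d := by
      have h1 : l1 (y' - ((L ^ m' : ℕ) : ℤ) • z) ≤ L ^ m' * d ^ 2 := by
        rw [hcast]
        refine (l1_sub_le_of_mem_box hy').trans ?_
        have hLle : L ≤ L ^ m' := by
          calc L = L ^ 1 := (pow_one L).symm
            _ ≤ L ^ m' := Nat.pow_le_pow_right (by omega) hm'1
        nlinarith
      exact l1_blk_sub_le hP1 h1
    exact norm_QbarIter_le_two_mul hL k hWu hx hs hWx (covLift M W Φ) c' hlift0 (hY c' hcz) m m' him y' μ hyc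
  -- (iii) sum over the levels: `Σ_{m<k+1} L^m ≤ L^{k+1} = M`
  unfold frameGen
  rw [← hM, framePotW_eq_sum]
  refine (norm_sum_le _ _).trans ((Finset.sum_le_sum hterm).trans ?_)
  have hgeo := sum_pow_le_pow_real hL (k + 1)
  have hc : (0 : ℝ) ≤ (d * L : ℝ) * (((2 * (d * L) + 1 : ℕ) : ℝ) ^ d * (d * (2 * (liftC d / M * s)))) := by positivity
  calc ∑ m ∈ Finset.range (k + 1), (d * L : ℝ) * (((2 * (d * L) + 1 : ℕ) : ℝ) ^ d * (d * (2 * (L : ℝ) ^ m * (liftC d / M * s))))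
      = (d * L : ℝ) * (((2 * (d * L) + 1 : ℕ) : ℝ) ^ d * (d * (2 * (liftC d / M * s)))) * ∑ m ∈ Finset.range (k + 1), (L : ℝ) ^ m := by
        rw [Finset.mul_sum]; exact Finset.sum_congr rfl fun m _ => by ring
    _ ≤ (d * L : ℝ) * (((2 * (d * L) + 1 : ℕ) : ℝ) ^ d * (d * (2 * (liftC d / M * s)))) * (L : ℝ) ^ (k + 1) := mul_le_mul_of_nonneg_left hgeo hc
    _ = frameC d L * liftC d * s := by rw [← hMr, frameC]; field_simp; push_cast; ring

/-! ## §3 The ℓ² and ℓ¹ sums of the frame generator over the coarse torus -/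

/-- **ℓ² OF THE FRAME GENERATOR**: for an `N`-periodic `Φ`,
`Σ_{z∈periodBox N} ‖frameGen L k W Φ z‖² ≤ (frameC·liftC)²·#l1Ball(frameRad)·dirSq Φ (periodBox N)`. [folklore] -/
theorem sum_normSq_frameGen_le [Nonempty n] {L : ℕ} (hL : 2 ≤ L) (k : ℕ) {W : Site d → Fin d → (Matrix n n ℂ)ˣ} {x : ℝ}
    (hWu : IsUnitaryCfg W) (hx : 0 ≤ x) (hs : LevelSmall d L k x) (hWx : SmallField W x) {N : ℕ} (hN : 1 ≤ N)
    {Φ : Site d → Fin d → Matrix n n ℂ} (hΦP : IsPeriodicDir Φ (N : ℤ)) :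
    ∑ z ∈ periodBox (d := d) N, ‖frameGen L k W Φ z‖ ^ 2
      ≤ (frameC d L * liftC d) ^ 2 * ((l1Ball (frameRad d L) : Finset (Site d))).card * dirSq Φ (periodBox (d := d) N) := by
  set S : Site d → ℝ := fun z => ∑ t ∈ l1Ball (frameRad d L), ∑ κ : Fin d, ‖Φ (z + t) κ‖ ^ 2 with hS
  have hS0 : ∀ z, 0 ≤ S z := fun z => Finset.sum_nonneg fun _ _ => Finset.sum_nonneg fun _ _ => sq_nonneg _
  have hpt : ∀ z : Site d, ‖frameGen L k W Φ z‖ ^ 2 ≤ (frameC d L * liftC d) ^ 2 * S z := by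
    intro z
    have h := norm_frameGen_le_loc hL k hWu hx hs hWx Φ z (s := Real.sqrt (S z)) (Real.sqrt_nonneg _)
      (fun z' κ' hz' => by rw [hS]; exact norm_le_locL2 Φ _ κ' hz')
    calc ‖frameGen L k W Φ z‖ ^ 2 ≤ (frameC d L * liftC d * Real.sqrt (S z)) ^ 2 := pow_le_pow_left₀ (norm_nonneg _) h 2
      _ = (frameC d L * liftC d) ^ 2 * S z := by rw [mul_pow, Real.sq_sqrt (hS0 z)]
  have hper : ∀ (z : Site d) (τ : Fin d), (∑ κ : Fin d, ‖Φ (z + (N : ℤ) • e τ) κ‖ ^ 2) = ∑ κ : Fin d, ‖Φ z κ‖ ^ 2 := by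
    intro z τ; exact Finset.sum_congr rfl fun κ _ => by rw [hΦP z τ κ]
  have hmult : ∑ z ∈ periodBox (d := d) N, S z
      = ((l1Ball (frameRad d L) : Finset (Site d))).card * ∑ z ∈ periodBox (d := d) N, ∑ κ : Fin d, ‖Φ z κ‖ ^ 2 := by
    have key := sum_periodBox_sum_l1Ball (g := fun w => ∑ κ : Fin d, ‖Φ w κ‖ ^ 2) hN hper (frameRad d L)
    beta_reduce at key
    rw [hS]; beta_reduce; exact key
  calc ∑ z ∈ periodBox (d := d) N, ‖frameGen L k W Φ z‖ ^ 2 ≤ ∑ z ∈ periodBox (d := d) N, (frameC d L * liftC d) ^ 2 * S z :=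
        Finset.sum_le_sum fun z _ => hpt z
    _ = (frameC d L * liftC d) ^ 2 * ((l1Ball (frameRad d L) : Finset (Site d))).card * dirSq Φ (periodBox (d := d) N) := by
        rw [← Finset.mul_sum, hmult]; unfold dirSq; ring

/-- **ℓ¹ OF THE FRAME GENERATOR**: for an `N`-periodic `Φ`,
`Σ_{z∈periodBox N} ‖frameGen L k W Φ z‖ ≤ frameC·liftC·#l1Ball(frameRad)·dirL1 Φ (periodBox N)`. [folklore] -/
theorem sum_norm_frameGen_le [Nonempty n] {L : ℕ} (hL : 2 ≤ L) (k : ℕ) {W : Site d → Fin d → (Matrix n n ℂ)ˣ} {x : ℝ}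
    (hWu : IsUnitaryCfg W) (hx : 0 ≤ x) (hs : LevelSmall d L k x) (hWx : SmallField W x) {N : ℕ} (hN : 1 ≤ N)
    {Φ : Site d → Fin d → Matrix n n ℂ} (hΦP : IsPeriodicDir Φ (N : ℤ)) :
    ∑ z ∈ periodBox (d := d) N, ‖frameGen L k W Φ z‖
      ≤ frameC d L * liftC d * ((l1Ball (frameRad d L) : Finset (Site d))).card * dirL1 Φ (periodBox (d := d) N) := by
  set S : Site d → ℝ := fun z => ∑ t ∈ l1Ball (frameRad d L), ∑ κ : Fin d, ‖Φ (z + t) κ‖ with hS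
  have hS0 : ∀ z, 0 ≤ S z := fun z => Finset.sum_nonneg fun _ _ => Finset.sum_nonneg fun _ _ => norm_nonneg _
  have hpt : ∀ z : Site d, ‖frameGen L k W Φ z‖ ≤ frameC d L * liftC d * S z := fun z =>
    norm_frameGen_le_loc hL k hWu hx hs hWx Φ z (s := S z) (hS0 z) (fun z' κ' hz' => by rw [hS]; exact norm_le_locL1 Φ _ κ' hz')
  have hper : ∀ (z : Site d) (τ : Fin d), (∑ κ : Fin d, ‖Φ (z + (N : ℤ) • e τ) κ‖) = ∑ κ : Fin d, ‖Φ z κ‖ := by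
    intro z τ; exact Finset.sum_congr rfl fun κ _ => by rw [hΦP z τ κ]
  have hmult : ∑ z ∈ periodBox (d := d) N, S z
      = ((l1Ball (frameRad d L) : Finset (Site d))).card * ∑ z ∈ periodBox (d := d) N, ∑ κ : Fin d, ‖Φ z κ‖ := by
    have key := sum_periodBox_sum_l1Ball (g := fun w => ∑ κ : Fin d, ‖Φ w κ‖) hN hper (frameRad d L)
    beta_reduce at key
    rw [hS]; beta_reduce; exact key
  calc ∑ z ∈ periodBox (d := d) N, ‖frameGen L k W Φ z‖ ≤ ∑ z ∈ periodBox (d := d) N, frameC d L * liftC d * S z :=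
        Finset.sum_le_sum fun z _ => hpt z
    _ = frameC d L * liftC d * ((l1Ball (frameRad d L) : Finset (Site d))).card * dirL1 Φ (periodBox (d := d) N) := by
        rw [← Finset.mul_sum, hmult]; unfold dirL1; ring

/-! ## §4 The ℓ² of a gauge direction of a periodic generator -/

/-- **ℓ² OF A GAUGE DIRECTION** (unitary `U`, `N`-periodic generator `m`): `Σ_{z∈periodBox N} Σ_α ‖gaugeDir U m z α‖² ≤ 4d·Σ_{z∈periodBox N} ‖m z‖²`.
[folklore] -/
theorem sum_normSq_gaugeDir_le {U : Site d → Fin d → (Matrix n n ℂ)ˣ} (hU : IsUnitaryCfg U) {N : ℕ} (hN : 1 ≤ N)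
    {m : Site d → Matrix n n ℂ} (hm : ∀ (z : Site d) (τ : Fin d), m (z + (N : ℤ) • e τ) = m z) :
    ∑ z ∈ periodBox (d := d) N, ∑ α : Fin d, ‖gaugeDir U m z α‖ ^ 2 ≤ 4 * d * ∑ z ∈ periodBox (d := d) N, ‖m z‖ ^ 2 := by
  have hpt : ∀ (z : Site d) (α : Fin d), ‖gaugeDir U m z α‖ ^ 2 ≤ 2 * ‖m z‖ ^ 2 + 2 * ‖m (z + e α)‖ ^ 2 := by
    intro z α
    have h : ‖gaugeDir U m z α‖ ≤ ‖m z‖ + ‖m (z + e α)‖ := by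
      unfold gaugeDir
      refine (norm_sub_le _ _).trans ?_
      rw [norm_Ad_of_unitary ((unitaryUnits _).inv_mem (hU z α))]
    have h2 := pow_le_pow_left₀ (norm_nonneg _) h 2
    nlinarith [sq_nonneg (‖m z‖ - ‖m (z + e α)‖)]
  calc ∑ z ∈ periodBox (d := d) N, ∑ α : Fin d, ‖gaugeDir U m z α‖ ^ 2
      ≤ ∑ z ∈ periodBox (d := d) N, ∑ α : Fin d, (2 * ‖m z‖ ^ 2 + 2 * ‖m (z + e α)‖ ^ 2) :=
        Finset.sum_le_sum fun z _ => Finset.sum_le_sum fun α _ => hpt z α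
    _ = ∑ α : Fin d, (2 * ∑ z ∈ periodBox (d := d) N, ‖m z‖ ^ 2 + 2 * ∑ z ∈ periodBox (d := d) N, ‖m (z + e α)‖ ^ 2) := by
        rw [Finset.sum_comm]
        exact Finset.sum_congr rfl fun α _ => by rw [Finset.sum_add_distrib, Finset.mul_sum, Finset.mul_sum]
    _ = ∑ _α : Fin d, 4 * ∑ z ∈ periodBox (d := d) N, ‖m z‖ ^ 2 := by
        refine Finset.sum_congr rfl fun α _ => ?_
        rw [sum_periodBox_shift N hN (g := fun w => ‖m w‖ ^ 2) (fun w τ => by simp only [hm w τ]) (e α)]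
        ring
    _ = 4 * d * ∑ z ∈ periodBox (d := d) N, ‖m z‖ ^ 2 := by rw [Finset.sum_const, Finset.card_univ, Fintype.card_fin, nsmul_eq_mul]; ring

end

end Summit.QuantumFields.BalabanUV.T4Continuum.NE3FrameGenLocal
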